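import Mathlib
import Summits.RiemannHypothesis.RiemannHypothesis.Theorems.WeilFarFloorCoshResidual
import Summits.RiemannHypothesis.RiemannHypothesis.Theorems.WeilFarFloorResidualCeilingRH
import Summits.RiemannHypothesis.RiemannHypothesis.Theorems.WeilFarFloorZeroEnergyMoments
import HarnessLib

/-!
# Tools for the lower half of the second-order law: AM–GM, truncation modulus, numeric budgets, zero energy

Helper file (`--supports stmt-RiemannHypothesis-0098`, lead-track anchor: Weil-positivity window ladder, format-C far bound),
pure proofs.  Seat rh-explicit-weil-1 gen15 (memo `run/shared/lean/pub/rh-explicit/rh-explicit-weil-1/FORMAT-K3.md` §16.4).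

* §1 weighted AM–GM under the integral `|∫pq| ≤ (θ∫p² + ∫q²/θ)/2`; `T_aC_a` vanishes off `[−3a, 3a]`; the modulus of the truncated
  residual `∫(r̃(x−y) − r̃(x))² ≤ 56W²e^aσ` (`r̃ = 1_{[−c,c]}(T_aC_a − RC_a)`, `|y| ≤ σ ≤ 1`, `0 ≤ R ≤ W`) — RH-free.
* §2 pure arithmetic of the scales `X = e^a`, `t = e^{−a}` (`Xt = 1`): the three budgets of the residual direction at
  `W = 76X`, `σ = t⁶`, `θ = t²`, `θ' = t³` are `≤ 10⁶t`, `≤ 10⁶`, `≤ 10⁶t`; and the master-constant inequality.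
* §3 the zero energy of a real Weil test with quadratic moduli, affine in `‖v‖²` (under RH):
  `Re Q_W(v) ≤ C·2π(log(2M + M₁ + 4) + 1/2)(2 + a²)·∫v² + C·2π` (`FloorZeroEnergy.weilQuadratic_re_le_of_quadraticModulus_of_RH`
  at `T₀ = 2M + M₁ + 1`).
Standard axioms only.
-/

set_option linter.dupNamespace false
set_option autoImplicit false

noncomputable section

open MeasureTheory Set Filter
open scoped Real Topology ArithmeticFunction.vonMangoldt

namespace Summit.RiemannHypothesis.RiemannHypothesis.Theorems.WeilFormatC

namespace FloorSecondOrder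

open Literature.NumberTheory.LFunctions FloorCosh FloorCoshSplit FloorZeroEnergy

variable {a : ℝ}

/-! ## §1 AM–GM and the truncated residual -/

/-- Weighted AM–GM under the integral: `|∫ p·q| ≤ (θ∫p² + (∫q²)/θ)/2` for `θ > 0`. -/
theorem abs_integral_mul_le_amgm {p q : ℝ → ℝ} (hpq : Integrable fun x ↦ p x * q x)
    (hp : Integrable fun x ↦ p x ^ 2) (hq : Integrable fun x ↦ q x ^ 2) {θ : ℝ} (hθ : 0 < θ) :
    |∫ x, p x * q x| ≤ (θ * (∫ x, p x ^ 2) + (∫ x, q x ^ 2) / θ) / 2 := by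
  refine (abs_integral_le_integral_abs (f := fun x ↦ p x * q x)).trans ?_
  have e : ∫ x, (θ * p x ^ 2 + q x ^ 2 / θ) / 2 = (θ * (∫ x, p x ^ 2) + (∫ x, q x ^ 2) / θ) / 2 := by
    rw [integral_div, integral_add (hp.const_mul θ) (hq.div_const θ), integral_const_mul, integral_div]
  rw [← e]
  refine integral_mono hpq.abs (((hp.const_mul θ).add (hq.div_const θ)).div_const 2) fun x ↦ ?_
  show |p x * q x| ≤ (θ * p x ^ 2 + q x ^ 2 / θ) / 2
  rw [abs_mul]
  have key : 2 * θ * (|p x| * |q x|) ≤ θ ^ 2 * p x ^ 2 + q x ^ 2 := by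
    nlinarith [sq_nonneg (θ * |p x| - |q x|), sq_abs (p x), sq_abs (q x)]
  have e2 : (θ * p x ^ 2 + q x ^ 2 / θ) / 2 = (θ ^ 2 * p x ^ 2 + q x ^ 2) / (2 * θ) := by
    field_simp
  rw [e2, le_div_iff₀ (by positivity)]
  linarith [key]

/-- `T_aC_a` vanishes off `[−3a, 3a]` (the shifts are `0 ≤ log n < 2a`). -/
theorem primeShiftOp_coshTest_eq_zero {x : ℝ} (hx : x ∉ Icc (-(3 * a)) (3 * a)) :
    (∑ n ∈ weilPrimeIndex a, (Λ n : ℝ) / Real.sqrt n *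
        ((Icc (-a) a).indicator (fun y ↦ Real.cosh (y / 2)) (x - Real.log n)
          + (Icc (-a) a).indicator (fun y ↦ Real.cosh (y / 2)) (x + Real.log n))) = 0 := by
  refine Finset.sum_eq_zero fun n hn ↦ ?_
  have hlog : Real.log n < 2 * a := mem_weilPrimeIndex.1 hn
  have hlog0 : 0 ≤ Real.log (n : ℝ) := Real.log_natCast_nonneg n
  obtain ⟨-, -, hCs⟩ := coshTest_admissible a
  rw [hCs (x - Real.log n), hCs (x + Real.log n), add_zero, mul_zero]
  · rintro ⟨h1, h2⟩; exact hx ⟨by linarith, by linarith⟩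
  · rintro ⟨h1, h2⟩; exact hx ⟨by linarith, by linarith⟩

/-- **Modulus of the truncated residual.**  For `a ≥ 1`, `Σ 2Λ/√n ≤ W`, `0 ≤ R ≤ W`, `σ ≤ 1`, `y ∈ [−σ, σ]` and any `c`:
`∫ (r̃(x − y) − r̃(x))² ≤ 56·W²·e^a·σ` for `r̃ = 1_{[−c,c]}(T_aC_a − R·C_a)` (truncation lemma + splitting +
`D_y(T_aC) ≤ 4A²D_y(C)` + the linear modulus of `C_a`). -/
theorem integral_sq_residualTrunc_shift_sub_le (ha : 1 ≤ a) {W R σ c : ℝ}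
    (hW : ∑ n ∈ weilPrimeIndex a, 2 * ((Λ n : ℝ) / Real.sqrt n) ≤ W) (hR0 : 0 ≤ R) (hRW : R ≤ W) (hσ1 : σ ≤ 1)
    {y : ℝ} (hy : y ∈ Icc (-σ) σ) :
    ∫ x, ((Icc (-c) c).indicator (fun x ↦
        (∑ n ∈ weilPrimeIndex a, (Λ n : ℝ) / Real.sqrt n *
          ((Icc (-a) a).indicator (fun z ↦ Real.cosh (z / 2)) (x - Real.log n)
            + (Icc (-a) a).indicator (fun z ↦ Real.cosh (z / 2)) (x + Real.log n)))
        - R * (Icc (-a) a).indicator (fun z ↦ Real.cosh (z / 2)) x) (x - y)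
      - (Icc (-c) c).indicator (fun x ↦
        (∑ n ∈ weilPrimeIndex a, (Λ n : ℝ) / Real.sqrt n *
          ((Icc (-a) a).indicator (fun z ↦ Real.cosh (z / 2)) (x - Real.log n)
            + (Icc (-a) a).indicator (fun z ↦ Real.cosh (z / 2)) (x + Real.log n)))
        - R * (Icc (-a) a).indicator (fun z ↦ Real.cosh (z / 2)) x) x) ^ 2
      ≤ 56 * W ^ 2 * Real.exp a * σ := by
  have ha0 : 0 ≤ a := by linarith
  obtain ⟨hCm, hCb, hCs⟩ := coshTest_admissible a
  -- the RH-free inputs, in explicit form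
  have hF := integral_sq_primeShiftOp_coshTest_shift_sub_le a (-y)
  have hC1 := coshTest_modulus_le ha hσ1 hy
  have hFs0 : ∀ x, x ∉ Icc (-(3 * a)) (3 * a) → _ = (0 : ℝ) := fun x hx ↦ primeShiftOp_coshTest_eq_zero (a := a) hx
  have hGb := abs_residualCore_le a R
  have hFb0 := fun x ↦ abs_primeShiftOp_le (b' := a) hCb x
  have hFm0 := measurable_primeShiftOp (b' := a) hCm
  set C : ℝ → ℝ := (Icc (-a) a).indicator (fun z ↦ Real.cosh (z / 2)) with hCdef
  set A := ∑ n ∈ weilPrimeIndex a, (Λ n : ℝ) / Real.sqrt n with hA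
  set F : ℝ → ℝ := fun x ↦ ∑ n ∈ weilPrimeIndex a, (Λ n : ℝ) / Real.sqrt n * (C (x - Real.log n) + C (x + Real.log n))
    with hFdef
  have hFx : ∀ x, F x = ∑ n ∈ weilPrimeIndex a, (Λ n : ℝ) / Real.sqrt n * (C (x - Real.log n) + C (x + Real.log n)) :=
    fun x ↦ rfl
  simp only [← hFx] at hF hFs0 hGb hFb0 ⊢
  set G : ℝ → ℝ := fun x ↦ F x - R * C x with hGdef
  set M₀ := (2 * A + |R|) * Real.cosh (a / 2) with hM₀
  -- admissibility of `F`, `−RC`, `G` on `[−3a, 3a]`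
  have hFm : Measurable F := hFm0
  have hFb : ∀ x, |F x| ≤ 2 * A * Real.cosh (a / 2) := hFb0
  have hFs : ∀ x, x ∉ Icc (-(3 * a)) (3 * a) → F x = 0 := hFs0
  have hCs3 : ∀ x, x ∉ Icc (-(3 * a)) (3 * a) → C x = 0 := fun x hx ↦
    hCs x fun h ↦ hx ⟨by linarith [h.1], by linarith [h.2]⟩
  have hqm : Measurable fun x ↦ -(R * C x) := (hCm.const_mul R).neg
  have hqb : ∀ x, |-(R * C x)| ≤ |R| * Real.cosh (a / 2) := fun x ↦ by
    rw [abs_neg, abs_mul]; exact mul_le_mul_of_nonneg_left (hCb x) (abs_nonneg R)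
  have hqs : ∀ x, x ∉ Icc (-(3 * a)) (3 * a) → -(R * C x) = 0 := fun x hx ↦ by rw [hCs3 x hx, mul_zero, neg_zero]
  have hGm : Measurable G := hFm.sub (hCm.const_mul R)
  have hGb' : ∀ x, |G x| ≤ M₀ := hGb
  have hGs : ∀ x, x ∉ Icc (-(3 * a)) (3 * a) → G x = 0 := fun x hx ↦ by
    show F x - R * C x = 0
    rw [hFs x hx, hCs3 x hx, mul_zero, sub_zero]
  -- `x − y = x + (−y)`
  have e1 : ∀ x : ℝ, x - y = x + -y := fun x ↦ sub_eq_add_neg x y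
  simp only [e1] at hC1 ⊢
  -- the chain of increments
  have h1 := integral_sq_shift_sub_indicator_mul_le (c := c) hGm hGb' hGs (-y)
  have h2 : ∫ x, (G (x + -y) - G x) ^ 2
      ≤ 2 * (∫ x, (F (x + -y) - F x) ^ 2) + 2 * (R ^ 2 * ∫ x, (C (x + -y) - C x) ^ 2) := by
    have h := integral_sq_shift_sub_add_le (p := F) (q := fun x ↦ -(R * C x)) hFm hqm hFb hqb hFs hqs (-y)
    have eL : ∫ x, (G (x + -y) - G x) ^ 2 = ∫ x, ((F (x + -y) + -(R * C (x + -y))) - (F x + -(R * C x))) ^ 2 :=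
      integral_congr_ae (Eventually.of_forall fun x ↦ by simp only [hGdef]; ring)
    have eR : ∫ x, (-(R * C (x + -y)) - -(R * C x)) ^ 2 = R ^ 2 * ∫ x, (C (x + -y) - C x) ^ 2 := by
      rw [← integral_const_mul]; exact integral_congr_ae (Eventually.of_forall fun x ↦ by ring)
    rw [eL, ← eR]; exact h
  have h3 : ∫ x, (F (x + -y) - F x) ^ 2 ≤ 4 * A ^ 2 * ∫ x, (C (x + -y) - C x) ^ 2 := hF
  have h4 : ∫ x, (C (x + -y) - C x) ^ 2 ≤ (a + Real.sinh a + 3) * σ := hC1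
  -- numerics
  set D := ∫ x, (C (x + -y) - C x) ^ 2 with hD
  set X := Real.exp a with hX
  have hD0 : 0 ≤ D := integral_nonneg fun _ ↦ sq_nonneg _
  have hσ0 : 0 ≤ σ := by linarith [hy.1, hy.2]
  have hyσ : |-y| ≤ σ := by rw [abs_neg, abs_le]; exact ⟨hy.1, hy.2⟩
  have hA0 : 0 ≤ A := Finset.sum_nonneg fun n _ ↦ div_nonneg ArithmeticFunction.vonMangoldt_nonneg (Real.sqrt_nonneg _)
  have hAW : 2 * A ≤ W := by rw [hA, Finset.mul_sum]; exact hW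
  have hW0 : 0 ≤ W := by linarith
  have hX1 : 1 ≤ X := Real.one_le_exp (by linarith)
  have hP3 : a + Real.sinh a + 3 ≤ 5 * X := by
    have h1 : Real.sinh a ≤ X / 2 := by rw [Real.sinh_eq, hX]; linarith only [Real.exp_pos (-a)]
    have h2 : a + 1 ≤ X := Real.add_one_le_exp a
    linarith
  have hcosh : Real.cosh (a / 2) ^ 2 ≤ X := by
    have h1 : Real.cosh (a / 2) ≤ Real.exp (a / 2) := by
      rw [Real.cosh_eq]
      have : Real.exp (-(a / 2)) ≤ Real.exp (a / 2) := Real.exp_le_exp.2 (by linarith only [ha0])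
      linarith only [this]
    have h2 : Real.exp (a / 2) ^ 2 = Real.exp a := by rw [sq, ← Real.exp_add]; ring_nf
    rw [hX, ← h2]
    exact pow_le_pow_left₀ (Real.cosh_pos _).le h1 2
  have hM₀W : M₀ ≤ 2 * W * Real.cosh (a / 2) := by
    rw [hM₀, abs_of_nonneg hR0]; exact mul_le_mul_of_nonneg_right (by linarith) (Real.cosh_pos _).le
  have hM₀0 : 0 ≤ M₀ := (abs_nonneg _).trans (hGb' 0)
  have hM0sq : M₀ ^ 2 ≤ 4 * W ^ 2 * X := by
    calc M₀ ^ 2 ≤ (2 * W * Real.cosh (a / 2)) ^ 2 := pow_le_pow_left₀ hM₀0 hM₀W 2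
      _ = 4 * W ^ 2 * Real.cosh (a / 2) ^ 2 := by ring
      _ ≤ 4 * W ^ 2 * X := mul_le_mul_of_nonneg_left hcosh (by positivity)
  have hA2 : 4 * A ^ 2 ≤ W ^ 2 := by nlinarith [hAW, hA0]
  have hR2 : R ^ 2 ≤ W ^ 2 := pow_le_pow_left₀ hR0 hRW 2
  have hDσ : D ≤ 5 * X * σ := h4.trans (mul_le_mul_of_nonneg_right hP3 hσ0)
  have h5 : 4 * A ^ 2 * D ≤ W ^ 2 * D := mul_le_mul_of_nonneg_right hA2 hD0
  have h6 : R ^ 2 * D ≤ W ^ 2 * D := mul_le_mul_of_nonneg_right hR2 hD0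
  have h7 : W ^ 2 * D ≤ W ^ 2 * (5 * X * σ) := mul_le_mul_of_nonneg_left hDσ (sq_nonneg W)
  have h8 : M₀ ^ 2 * |-y| ≤ M₀ ^ 2 * σ := mul_le_mul_of_nonneg_left hyσ (sq_nonneg _)
  have h9 : M₀ ^ 2 * σ ≤ 4 * W ^ 2 * X * σ := mul_le_mul_of_nonneg_right hM0sq hσ0
  linarith [h1, h2, h3, h5, h6, h7, h8, h9]

/-! ## §2 Arithmetic of the scales -/

/-- **The three budgets in numbers.**  With `Xt = 1`, `0 < t ≤ 1`, `P ≤ X` (`W = 76X`, `σ = t⁶`, `θ = t²`, `θ' = t³`):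
`E_C = 8WXσ + (θP + 224W²Xσ/θ)/2 ≤ 10⁶t`, `E_F = 8W²Xσ + (θ'W²P + 224W²Xσ/θ')/2 ≤ 10⁶`, `S = (θP + 224W²Xσ/θ)/2 ≤ 10⁶t`. -/
theorem lowerHalf_budgets_le {X t P : ℝ} (hXt : X * t = 1) (ht0 : 0 < t) (ht1 : t ≤ 1) (hPX : P ≤ X) :
    8 * (76 * X) * X * t ^ 6 + (t ^ 2 * P + 224 * (76 * X) ^ 2 * X * t ^ 6 / t ^ 2) / 2 ≤ 10 ^ 6 * t ∧
    8 * (76 * X) ^ 2 * X * t ^ 6 + (t ^ 3 * ((76 * X) ^ 2 * P) + 224 * (76 * X) ^ 2 * X * t ^ 6 / t ^ 3) / 2 ≤ 10 ^ 6 ∧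
    (t ^ 2 * P + 224 * (76 * X) ^ 2 * X * t ^ 6 / t ^ 2) / 2 ≤ 10 ^ 6 * t := by
  have e26 : X ^ 2 * t ^ 6 = t ^ 4 := by
    calc X ^ 2 * t ^ 6 = (X * t) ^ 2 * t ^ 4 := by ring
      _ = t ^ 4 := by rw [hXt]; ring
  have e12 : X * t ^ 2 = t := by
    calc X * t ^ 2 = (X * t) * t := by ring
      _ = t := by rw [hXt]; ring
  have e33 : X ^ 3 * t ^ 3 = 1 := by
    calc X ^ 3 * t ^ 3 = (X * t) ^ 3 := by ring
      _ = 1 := by rw [hXt]; ring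
  have e36 : X ^ 3 * t ^ 6 = t ^ 3 := by
    calc X ^ 3 * t ^ 6 = (X * t) ^ 3 * t ^ 3 := by ring
      _ = t ^ 3 := by rw [hXt]; ring
  have ht4 : t ^ 4 ≤ t := pow_le_of_le_one ht0.le ht1 (by norm_num)
  have ht3 : t ^ 3 ≤ 1 := pow_le_one₀ ht0.le ht1
  have hP2 : t ^ 2 * P ≤ t := by
    have := mul_le_mul_of_nonneg_left hPX (sq_nonneg t); linarith only [this, e12]
  have hq2 : 224 * (76 * X) ^ 2 * X * t ^ 6 / t ^ 2 = 1293824 * t := by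
    rw [div_eq_iff (by positivity)]; linear_combination (1293824 : ℝ) * e36
  have hS : (t ^ 2 * P + 224 * (76 * X) ^ 2 * X * t ^ 6 / t ^ 2) / 2 ≤ 646913 * t := by
    rw [hq2]; linarith only [hP2, ht0]
  refine ⟨?_, ?_, by linarith only [hS, ht0]⟩
  · have h1 : 8 * (76 * X) * X * t ^ 6 = 608 * t ^ 4 := by linear_combination (608 : ℝ) * e26
    rw [h1]; linarith only [hS, ht4, ht0]
  · have h1 : 8 * (76 * X) ^ 2 * X * t ^ 6 = 46208 * t ^ 3 := by linear_combination (46208 : ℝ) * e36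
    have h2 : t ^ 3 * ((76 * X) ^ 2 * P) ≤ 5776 := by
      have h5 := mul_le_mul_of_nonneg_left hPX (by positivity : 0 ≤ t ^ 3 * (76 * X) ^ 2)
      have e : t ^ 3 * (76 * X) ^ 2 * X = 5776 := by linear_combination (5776 : ℝ) * e33
      linarith only [h5, e]
    have h3 : 224 * (76 * X) ^ 2 * X * t ^ 6 / t ^ 3 = 1293824 := by
      rw [div_eq_iff (by positivity)]; linear_combination (1293824 * t ^ 3 : ℝ) * e33
    rw [h1, h3]; linarith only [h2, ht3]

/-- The master-constant inequality: `E·(η/(10⁸S)) ≤ η/10⁸` for `E ≤ S`, `S > 0`, `η ≥ 0`. -/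
theorem mul_master_le {η S E : ℝ} (hη : 0 ≤ η) (hES : E ≤ S) (hS : 0 < S) :
    E * (η / (10 ^ 8 * S)) ≤ η / 10 ^ 8 := by
  have h1 : E / S ≤ 1 := by rw [div_le_one hS]; exact hES
  calc E * (η / (10 ^ 8 * S)) = E / S * (η / 10 ^ 8) := by field_simp
    _ ≤ 1 * (η / 10 ^ 8) := mul_le_mul_of_nonneg_right h1 (by positivity)
    _ = η / 10 ^ 8 := one_mul _

/-! ## §3 The zero energy of a direction with quadratic moduli, affine form (under RH) -/

/-- **Zero energy, affine in `‖v‖²`.**  There is `C > 0` such that, under RH, for every real Weil test `v` with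
`∫‖v(·+h) − v‖² ≤ Mh²`, `∫‖(x+h)v(x+h) − xv(x)‖² ≤ M₁h²` (`0 < h ≤ h₀`), and `∫x²v² ≤ a²∫v²`:
`Re Q_W(v) ≤ C·2π·(log(2M + M₁ + 4) + 1/2)(2 + a²)·∫v² + C·2π`. -/
theorem weilQuadratic_re_le_affine_of_RH :
    ∃ C : ℝ, 0 < C ∧ ∀ {v : ℝ → ℝ} {a M M₁ h₀ : ℝ}, IsWeilTest (fun x ↦ (v x : ℂ)) → RiemannHypothesis →
      0 < h₀ → 0 ≤ M → 0 ≤ M₁ →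
      (∀ h : ℝ, 0 < h → h ≤ h₀ → ∫ x, ‖((v (x + h) : ℝ) : ℂ) - ((v x : ℝ) : ℂ)‖ ^ 2 ≤ M * h ^ 2) →
      (∀ h : ℝ, 0 < h → h ≤ h₀ →
        ∫ x, ‖((x + h : ℝ) : ℂ) * ((v (x + h) : ℝ) : ℂ) - (x : ℂ) * ((v x : ℝ) : ℂ)‖ ^ 2 ≤ M₁ * h ^ 2) →
      (∫ x, x ^ 2 * v x ^ 2 ≤ a ^ 2 * ∫ x, v x ^ 2) →
      (weilQuadratic fun x ↦ (v x : ℂ)).re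
        ≤ C * (2 * π) * ((Real.log (2 * M + M₁ + 4) + 1 / 2) * (2 + a ^ 2)) * (∫ x, v x ^ 2) + C * (2 * π) := by
  obtain ⟨C, hC0, hZ⟩ := weilQuadratic_re_le_of_quadraticModulus_of_RH
  refine ⟨C, hC0, fun {v a M M₁ h₀} hv hRH hh₀ hM0 hM₁0 hmod hmodx hx2 ↦ ?_⟩
  set T₀ := 2 * M + M₁ + 1 with hT₀
  have hT₀1 : 1 ≤ T₀ := by rw [hT₀]; linarith only [hM0, hM₁0]
  have hZv := hZ hv hRH hh₀ hT₀1 hmod hmodx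
  have hNv0 : 0 ≤ ∫ x, v x ^ 2 := integral_nonneg fun x ↦ sq_nonneg _
  have hn1 : ∫ x, ‖((v x : ℝ) : ℂ)‖ ^ 2 = ∫ x, v x ^ 2 :=
    integral_congr_ae (Eventually.of_forall fun x ↦ by simp only [Complex.norm_real, Real.norm_eq_abs, sq_abs])
  have hn2 : ∫ x, x ^ 2 * ‖((v x : ℝ) : ℂ)‖ ^ 2 = ∫ x, x ^ 2 * v x ^ 2 :=
    integral_congr_ae (Eventually.of_forall fun x ↦ by simp only [Complex.norm_real, Real.norm_eq_abs, sq_abs])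
  have hZv' : (weilQuadratic fun x ↦ (v x : ℂ)).re
      ≤ C * (2 * π * ((Real.log (T₀ + 3) + 1 / (2 * T₀)) * (2 * (∫ x, v x ^ 2) + ∫ x, x ^ 2 * v x ^ 2)
        + 24 / 43 * (2 * M + M₁) / T₀)) := by
    rw [← hn1, ← hn2]; exact hZv
  refine hZv'.trans ?_
  have hlog0 : 0 ≤ Real.log (T₀ + 3) := Real.log_nonneg (by linarith only [hT₀1])
  have h1 : 1 / (2 * T₀) ≤ 1 / 2 := one_div_le_one_div_of_le (by norm_num) (by linarith only [hT₀1])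
  have h3 : (Real.log (T₀ + 3) + 1 / (2 * T₀)) * (2 * (∫ x, v x ^ 2) + ∫ x, x ^ 2 * v x ^ 2)
      ≤ (Real.log (T₀ + 3) + 1 / 2) * ((2 + a ^ 2) * ∫ x, v x ^ 2) :=
    mul_le_mul (by linarith only [h1]) (by linarith only [hx2])
      (by have : 0 ≤ ∫ x, x ^ 2 * v x ^ 2 := integral_nonneg fun x ↦ by positivity
          linarith only [this, hNv0]) (by positivity)
  have h4 : 24 / 43 * (2 * M + M₁) / T₀ ≤ 1 := by
    rw [div_le_one (by linarith only [hT₀1]), hT₀]; linarith only [hM0, hM₁0]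
  have h5 : 2 * π * ((Real.log (T₀ + 3) + 1 / (2 * T₀)) * (2 * (∫ x, v x ^ 2) + ∫ x, x ^ 2 * v x ^ 2)
        + 24 / 43 * (2 * M + M₁) / T₀)
      ≤ 2 * π * ((Real.log (T₀ + 3) + 1 / 2) * ((2 + a ^ 2) * ∫ x, v x ^ 2) + 1) :=
    mul_le_mul_of_nonneg_left (add_le_add h3 h4) (by positivity)
  have e : T₀ + 3 = 2 * M + M₁ + 4 := by rw [hT₀]; ring
  calc C * (2 * π * ((Real.log (T₀ + 3) + 1 / (2 * T₀)) * (2 * (∫ x, v x ^ 2) + ∫ x, x ^ 2 * v x ^ 2)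
          + 24 / 43 * (2 * M + M₁) / T₀))
      ≤ C * (2 * π * ((Real.log (T₀ + 3) + 1 / 2) * ((2 + a ^ 2) * ∫ x, v x ^ 2) + 1)) :=
        mul_le_mul_of_nonneg_left h5 hC0.le
    _ = C * (2 * π) * ((Real.log (2 * M + M₁ + 4) + 1 / 2) * (2 + a ^ 2)) * (∫ x, v x ^ 2) + C * (2 * π) := by
        rw [e]; ring

end FloorSecondOrder

end Summit.RiemannHypothesis.RiemannHypothesis.Theorems.WeilFormatC
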